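import Literature.AlgebraicGeometry.Resolution.ArithmeticalThreefolds
import Mathlib.RingTheory.Ideal.GoingUp
import Mathlib.RingTheory.KrullDimension.Polynomial
import Mathlib.RingTheory.KrullDimension.Field
import Mathlib.RingTheory.NoetherNormalization
import Mathlib.RingTheory.AlgebraicIndependent.TranscendenceBasis
import Mathlib.RingTheory.AlgebraicIndependent.Transcendental
import Mathlib.RingTheory.Algebraic.Basic
import HarnessLib

/-!
# Krull dimension of affine domains equals transcendence degree

Topic: `Literature/AlgebraicGeometry/Resolution`. The classical dimension theorem for finitely
generated domains over a field (Matsumura, *Commutative Ring Theory*, Thm. 5.6 / §14; Eisenbud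
Thm. A p. 221): `dim A = trdeg_k Frac(A)`, proved from Mathlib's Noether normalization
(`Algebra.exists_integral_inj_algHom_of_fg`), invariance of Krull dimension under injective
integral extensions (going up + incomparability, proved here: `ringKrullDim_eq_of_isIntegral`),
`dim k[X₁,…,Xₙ] = n` (`MvPolynomial.ringKrullDim_of_isNoetherianRing`) and additivity of
transcendence degree (`Algebra.trdeg_add_eq`, `trdeg_eq_zero`). The easy inequality
`dim ≤ trdeg` for arbitrary `k`-domains is `ringKrullDim_le_of_trdeg_le`
(`InseparableLocalUniformization.lean`); here the finitely generated case gives equality.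

Purpose (reviewer of p4321, `ArithmeticalThreefolds.lean`): the bridge
`LocalUniformization3 k → RelLocalUniformization k K O` for function fields `K/k` of
transcendence degree `≤ 3` (`LocalUniformization3.relLocalUniformization`), hence
`CossartPiltant2019 → RelLocalUniformization` in transcendence degree `≤ 3`
(`CossartPiltant2019LU3.relLocalUniformization`).
-/

noncomputable section

open Cardinal

namespace Literature.AlgebraicGeometry.Resolution

universe u v

/-! ## Krull dimension of integral extensions -/

section Integral

variable {R : Type u} {S : Type v} [CommRing R] [CommRing S] [Algebra R S]

/-- **Going up along chains**: over an injective integral extension every strictly increasing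
chain of primes of `R` is the contraction of a strictly increasing chain of primes of `S` of the
same length (Matsumura Thm. 9.4). [cite: Matsumura1987, Thm. 9.4] -/
theorem exists_ltSeries_comap_last_eq [Algebra.IsIntegral R S]
    (hinj : Function.Injective (algebraMap R S)) (l : LTSeries (PrimeSpectrum R)) :
    ∃ l' : LTSeries (PrimeSpectrum S), l'.length = l.length ∧
      l'.last.asIdeal.comap (algebraMap R S) = l.last.asIdeal := by
  suffices H : ∀ (n : ℕ) (l : LTSeries (PrimeSpectrum R)), l.length = n →
      ∃ l' : LTSeries (PrimeSpectrum S), l'.length = n ∧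
        l'.last.asIdeal.comap (algebraMap R S) = l.last.asIdeal from
    H l.length l rfl
  intro n
  induction n with
  | zero =>
    intro l hl
    obtain ⟨Q, -, hQ, hQP⟩ := Ideal.exists_ideal_over_prime_of_isIntegral l.last.asIdeal
      (⊥ : Ideal S) (by
        rw [← RingHom.ker_eq_comap_bot, (RingHom.injective_iff_ker_eq_bot _).mp hinj]
        exact bot_le)
    exact ⟨RelSeries.singleton _ ⟨Q, hQ⟩, rfl, hQP⟩
  | succ n ih =>
    intro l hl
    have hl0 : l.length ≠ 0 := by omega
    obtain ⟨l₀, hl₀, hlast⟩ := ih l.eraseLast (by simp [hl])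
    have hlt : l.eraseLast.last < l.last := l.eraseLast_last_rel_last hl0
    obtain ⟨Q, hQge, hQ, hQP⟩ := Ideal.exists_ideal_over_prime_of_isIntegral l.last.asIdeal
      l₀.last.asIdeal (by rw [hlast]; exact le_of_lt hlt)
    have hlt' : l₀.last < ⟨Q, hQ⟩ := by
      refine lt_of_le_of_ne hQge fun h => ?_
      have : l.eraseLast.last.asIdeal = l.last.asIdeal := by
        rw [← hlast, ← hQP, h]
      exact (ne_of_lt hlt) (PrimeSpectrum.ext this)
    refine ⟨l₀.snoc ⟨Q, hQ⟩ hlt', by simp [hl₀], ?_⟩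
    rw [RelSeries.last_snoc]
    exact hQP

/-- **Krull dimension is invariant under injective integral extensions** (Matsumura Thm. 9.4
with Ex. 9.2: going up gives `dim S ≥ dim R`, incomparability gives `dim S ≤ dim R`).
[cite: Matsumura1987, Thm. 9.4] -/
theorem ringKrullDim_eq_of_isIntegral [Algebra.IsIntegral R S]
    (hinj : Function.Injective (algebraMap R S)) : ringKrullDim S = ringKrullDim R := by
  apply le_antisymm
  · exact Order.krullDim_le_of_strictMono
      (fun p : PrimeSpectrum S => PrimeSpectrum.comap (algebraMap R S) p)
      (fun p q h => Ideal.IsIntegral.comap_lt_comap (R := R) h)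
  · unfold ringKrullDim Order.krullDim
    refine iSup_le fun l => ?_
    obtain ⟨l', hl', -⟩ := exists_ltSeries_comap_last_eq hinj l
    exact le_iSup_of_le l' (by rw [hl'])

end Integral

/-! ## The dimension theorem for affine domains -/

/-- **`dim A = trdeg_k A` for a finitely generated domain `A` over a field `k`** (Matsumura
Thm. 5.6; here: some natural number `n` is both). Proof: Noether normalization
`k[X₁,…,Xₙ] ↪ A` finite injective; `dim` and `trdeg` are both invariant along it and both equal
`n` on the polynomial ring. [cite: Matsumura1987, Thm. 5.6] -/
theorem exists_ringKrullDim_eq_and_trdeg_eq (k : Type u) (A : Type u) [Field k] [CommRing A]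
    [IsDomain A] [Algebra k A] [Algebra.FiniteType k A] :
    ∃ n : ℕ, ringKrullDim A = n ∧ Algebra.trdeg k A = n := by
  obtain ⟨s, g, hg, hint⟩ := exists_integral_inj_algHom_of_fg k A
  let P := MvPolynomial (Fin s) k
  letI : Algebra P A := g.toRingHom.toAlgebra
  haveI : IsScalarTower k P A := IsScalarTower.of_algebraMap_eq fun x => (g.commutes x).symm
  haveI : Algebra.IsIntegral P A := ⟨fun a => hint a⟩
  have hinj : Function.Injective (algebraMap P A) := hg
  haveI : FaithfulSMul P A := (faithfulSMul_iff_algebraMap_injective P A).mpr hinj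
  refine ⟨s, ?_, ?_⟩
  · rw [ringKrullDim_eq_of_isIntegral hinj, MvPolynomial.ringKrullDim_of_isNoetherianRing,
      ringKrullDim_eq_zero_of_field, Nat.card_eq_fintype_card, Fintype.card_fin, zero_add]
  · haveI : Algebra.IsAlgebraic P A := Algebra.IsIntegral.isAlgebraic
    rw [← trdeg_add_eq k P (A := A), trdeg_eq_zero (R := P) (A := A), add_zero,
      MvPolynomial.trdeg_of_isDomain, Cardinal.mk_fintype, Fintype.card_fin]
    simp

/-- The transcendence degree of `K/k` is that of any affine model: for a `k`-subalgebra `A`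
with `Frac A = K`, `trdeg_k K = trdeg_k A`. [folklore] -/
theorem trdeg_eq_trdeg_of_isFractionRing {k K : Type u} [Field k] [Field K] [Algebra k K]
    (A : Subalgebra k K) [IsFractionRing A K] : Algebra.trdeg k K = Algebra.trdeg k A := by
  haveI : Algebra.IsAlgebraic A K := IsLocalization.isAlgebraic K (nonZeroDivisors A)
  rw [← trdeg_add_eq k A (A := K), trdeg_eq_zero (R := A) (A := K), add_zero]

/-- The Krull dimension of an affine model of `K/k` is at most `d` as soon as `trdeg_k K ≤ d`.
[cite: Matsumura1987, Thm. 5.6] -/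
theorem ringKrullDim_le_of_fg_of_trdeg_le {k K : Type u} [Field k] [Field K] [Algebra k K]
    (A : Subalgebra k K) (hfg : A.FG) [IsFractionRing A K] {d : ℕ}
    (hd : Algebra.trdeg k K ≤ d) : ringKrullDim A ≤ d := by
  haveI : Algebra.FiniteType k A := A.fg_iff_finiteType.mp hfg
  obtain ⟨n, hn, htr⟩ := exists_ringKrullDim_eq_and_trdeg_eq k A
  rw [trdeg_eq_trdeg_of_isFractionRing A, htr] at hd
  rw [hn]
  exact_mod_cast hd

/-- **Bridge** (`LocalUniformization3` ⇒ `RelLocalUniformization` in transcendence degree `≤ 3`):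
relative local uniformization in dimension `≤ 3` over `k` uniformizes every valuation ring of a
function field `K/k` of transcendence degree `≤ 3` relative to any prescribed affine model
(whose dimension is `≤ 3` by the dimension theorem). [folklore] -/
theorem LocalUniformization3.relLocalUniformization {k : Type} [Field k]
    (h : LocalUniformization3.{0} k) (K : Type) [Field K] [Algebra k K]
    (hK : Algebra.trdeg k K ≤ 3) (O : ValuationSubring K) : RelLocalUniformization k K O := by
  intro R hfg hfr hRO
  haveI := hfr
  obtain ⟨A', h', hle, hfg', hreg⟩ :=
    h K O R hRO hfg hfr (ringKrullDim_le_of_fg_of_trdeg_le R hfg (by exact_mod_cast hK))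
  exact ⟨A', h', hle, hfg', hreg⟩

/-- Under `CossartPiltant2019LU3` (a corollary of `CossartPiltant2019`, `ResolutionLU.lean`),
every valuation ring of a function field of transcendence degree `≤ 3` over any field satisfies
relative local uniformization. [cite: CossartPiltant2019, Thm. 1.1 with §4.1 (LU)] -/
theorem CossartPiltant2019LU3.relLocalUniformization (h : CossartPiltant2019LU3.{0})
    (k K : Type) [Field k] [Field K] [Algebra k K] (hK : Algebra.trdeg k K ≤ 3)
    (O : ValuationSubring K) : RelLocalUniformization k K O :=
  (h k).relLocalUniformization K hK O

end Literature.AlgebraicGeometry.Resolution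

end
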